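import Mathlib
import Summits.NavierStokesRegularity.NavierStokesRegularity.Theorems.EulerZoomLiouvillePowerGaugeEulerLiouvilleSwirlfreeLedgerDecay
import Literature.Analysis.FluidPDE.ReflectedGluedField
import Literature.Analysis.FluidPDE.SwirlTransportProofs
import HarnessLib

/-!
# Crux `EulerZoomLiouville.PowerGaugeEulerLiouville` (stmt-NavierStokesRegularity-19832), line `swirl-capacity`, stub D3:
# THE SWIRL ENDGAME — capacity floor + persistent swirl blobs + the `E`-gauge leave no room for swirl (`stub_swirlEndgame`, unfolded)

Route №10 `EulerZoomLiouville` (NavierStokesRegularity), crux E.  Line `swirl-capacity` (ideator ns-idea-11 g3;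
`Cruxes/PowerGaugeEulerLiouville/Lines/swirl_capacity.lean`), registered stub `stub_swirlEndgame` (D3), proved here with its signature
UNFOLDED in the tree's vocabulary (the line's `SwirlCapacityFloor`, `InClass`, `IsAxiDriftingWith`, `HasPastSwirl`, `SwirlBlobsPersist`,
`VanishesAE`, `driftRadius` are `def`s of the Cruxes file; the statement below is their `δ`-unfolding — the same unfolded forms as the D1
file `…SwirlCapacityTransport` — so the skeleton fills the stub by `exact`).

THE ARGUMENT (the card's D3; in truth the hypotheses are contradictory, so the conclusion holds vacuously).  Suppose a past slice carries
swirl: `Γ(τ₀, x₁) ≠ 0`, `τ₀ < 0`.  Then `x₁` is off the axis (`Γ = 0` there) and by continuity there is a blob `B(x₁, δ)` (`δ < r(x₁)`) on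
which `|Γ(τ₀,·)| ≥ γ₀ = |Γ(τ₀,x₁)|/2 > 0`, of volume `V > 0` (`exists_swirl_blob`).  By blob persistence (D1, hypothesis) every earlier slice
`t₁ < τ₀` has a measurable avatar `T ⊆ B(0, ‖x₁‖ + δ + driftRadius M κ τ₀ t₁)` with `|Γ(t₁,·)| ≥ γ₀` on `T` and `vol T ≥ V`; for
`t₁ ∈ (−T_a, τ₀)` with `T_a = c₂ a^{min(2, 1/(1−κ))}`, `c₂ = min(1, ((1−κ)/(6 max(M,1)))^{1/(1−κ)})`, `a ≥ 6(‖x₁‖+δ)`, the drift radius is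
`≤ a/6`, so `T ⊆ B(0, a/3)` and the swirl capacity floor (D2/D2', hypothesis, at `A = a/3`) gives
`∫_{B(a)} ‖∇u(t₁)‖_F² ≥ F_a = K γ₀² / ((a/3)(1 + log⁺((a/3)³/V)))`.  Integrating in `t₁` (Tonelli, `frobenius_window_lower_bound`) and comparing
with the `E`-gauge budget `∫∫_{Q(a)} ‖∇u‖_F² ≤ c a^{1−ρ}` (the landed window lemma `setLIntegral_window_frobenius_fderiv_le`) yields
`(T_a + τ₀) F_a ≤ c a^{1−ρ}`, i.e. `T_a K γ₀² ≤ (c/3) a^{2−ρ}(1 + 3 log a + |log V|) + |τ₀| K γ₀²`, which fails for large `a` because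
`min(2, 1/(1−κ)) > 2 − ρ` — the exponent race `1/(1−κ) > 2−ρ ⇔ κ > (1−ρ)/(2−ρ)` (`eventually_dominates`).

* `continuous_frobeniusNormSq` — the Frobenius form is continuous on `E3 →L E3`;
* `frobenius_window_lower_bound` — per-slice lower bounds for `∫_{B(a)} ‖∇u(t)‖_F²` on a sub-window integrate (Tonelli);
* `exists_swirl_blob` — a non-zero swirl value yields an off-axis superlevel blob of positive volume;
* `eventually_dominates` — `C₁ a^e log a + C₂ a^e + C₃ < c a^s` for large `a` when `e < s`, `c > 0`;
* **`vanishesAE_of_swirlCapacityFloor_of_swirlBlobsPersist`** — the stub signature, unfolded.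

WHAT THIS IS NOT: not NS, not the crux — a helper `--supports` stmt-19832 on the line `swirl-capacity` (strata lemmas about a hypothetical
class of ancient Euler solutions; the floor D2 and the residue D4 are NOT touched here); no summit statement is proved here.
[cite: MajdaBertozziCUP2002, §2.3.3 (2.67); CaffarelliKohnNirenberg1982, §2 (the scaled dissipation)]
-/

noncomputable section

-- flat `Theorems/<Route><Decl>…` files of one crux share the namespace of the crux (tree convention)
set_option linter.dupNamespace false

open MeasureTheory Set Filter Topology Metric Function
open scoped NNReal ENNReal

namespace Summit.NavierStokesRegularity.NavierStokesRegularity.Theorems.PowerGaugeEulerLiouville.SwirlCapacity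

open Literature.Analysis Literature.Analysis.FluidPDE
open Summit.NavierStokesRegularity.NavierStokesRegularity.Theorems.PowerGaugeEulerLiouville.SwirlfreeLedger

variable {u : ℝ → EuclideanSpace ℝ (Fin 3) → EuclideanSpace ℝ (Fin 3)} {p : ℝ → EuclideanSpace ℝ (Fin 3) → ℝ}

/-! ### The window enstrophy: a Tonelli lower bound -/

/-- The squared Frobenius norm is a continuous function of the linear map (a finite sum of squared norms of evaluations). [folklore] -/
theorem continuous_frobeniusNormSq :
    Continuous (frobeniusNormSq : (EuclideanSpace ℝ (Fin 3) →L[ℝ] EuclideanSpace ℝ (Fin 3)) → ℝ) := by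
  unfold frobeniusNormSq
  exact continuous_finsetSum _ fun i _ =>
    ((ContinuousLinearMap.apply ℝ (EuclideanSpace ℝ (Fin 3))
      (stdOrthonormalBasis ℝ (EuclideanSpace ℝ (Fin 3)) i)).continuous.norm).pow 2

/-- **Per-slice lower bounds integrate** (Tonelli): if `∫_{B(a)} ‖∇u(t)‖_F² ≥ F ≥ 0` for every `t` in a sub-window `(α, β)` of `(−a², 0)`,
then `(β − α) F ≤ ∫∫_{(−a²,0)×B(a)} ‖∇u‖_F²` (the gradient of a classical solution is jointly continuous on the slab). [folklore] -/
theorem frobenius_window_lower_bound (hcl : IsClassicalEulerSolutionOn (Iio 0) 0 u p) {a α β F : ℝ}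
    (hαa : -a ^ 2 ≤ α) (hβ : β ≤ 0) (hF : 0 ≤ F)
    (hslice : ∀ t ∈ Ioo α β,
      ENNReal.ofReal F ≤ ∫⁻ x in ball (0 : EuclideanSpace ℝ (Fin 3)) a, ENNReal.ofReal (frobeniusNormSq (fderiv ℝ (u t) x))) :
    ENNReal.ofReal ((β - α) * F) ≤
      ∫⁻ z in Ioo (-a ^ 2) 0 ×ˢ ball (0 : EuclideanSpace ℝ (Fin 3)) a, ENNReal.ofReal (frobeniusNormSq (fderiv ℝ (u z.1) z.2)) := by
  -- adapted from the casimir-floor endgame (`window_lower_bound`), integrand `‖∇u‖_F²` instead of `|curl u|²`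
  set I : Set ℝ := Ioo α β with hI
  set B : Set (EuclideanSpace ℝ (Fin 3)) := ball 0 a with hB
  have hsub : I ×ˢ B ⊆ Ioo (-a ^ 2) 0 ×ˢ B := prod_mono (Ioo_subset_Ioo hαa hβ) Subset.rfl
  refine le_trans ?_ (lintegral_mono_set hsub)
  have hIsub : I ×ˢ B ⊆ Iio (0 : ℝ) ×ˢ (univ : Set (EuclideanSpace ℝ (Fin 3))) :=
    prod_mono (fun s hs => lt_of_lt_of_le hs.2 hβ) (subset_univ _)
  have hμ : ((volume : Measure ℝ).restrict I).prod ((volume : Measure (EuclideanSpace ℝ (Fin 3))).restrict B) =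
      (volume : Measure (ℝ × EuclideanSpace ℝ (Fin 3))).restrict (I ×ˢ B) := by
    rw [Measure.prod_restrict, ← Measure.volume_eq_prod]
  have hgm : AEMeasurable
      (uncurry fun (t : ℝ) (x : EuclideanSpace ℝ (Fin 3)) => ENNReal.ofReal (frobeniusNormSq (fderiv ℝ (u t) x)))
      (((volume : Measure ℝ).restrict I).prod ((volume : Measure (EuclideanSpace ℝ (Fin 3))).restrict B)) := by
    rw [hμ]
    have hD : ContinuousOn (uncurry fun (t : ℝ) (x : EuclideanSpace ℝ (Fin 3)) => fderiv ℝ (u t) x)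
        (Iio (0 : ℝ) ×ˢ (univ : Set (EuclideanSpace ℝ (Fin 3)))) :=
      (hcl.smooth_velocity.fderiv_slice isOpen_Iio.uniqueDiffOn).continuousOn
    have hc : AEMeasurable (fun z : ℝ × EuclideanSpace ℝ (Fin 3) => frobeniusNormSq (fderiv ℝ (u z.1) z.2))
        (volume.restrict (I ×ˢ B)) :=
      ((continuous_frobeniusNormSq.comp_continuousOn hD).mono hIsub).aemeasurable (measurableSet_Ioo.prod measurableSet_ball)
    exact hc.ennreal_ofReal
  have hT := lintegral_lintegral hgm
  rw [hμ] at hT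
  rw [← hT]
  calc ENNReal.ofReal ((β - α) * F) = ∫⁻ _ in I, ENNReal.ofReal F := by
        rw [setLIntegral_const, Real.volume_Ioo, ← ENNReal.ofReal_mul (by linarith), mul_comm]
    _ ≤ ∫⁻ t in I, ∫⁻ x in B, ENNReal.ofReal (frobeniusNormSq (fderiv ℝ (u t) x)) := setLIntegral_mono' measurableSet_Ioo hslice

/-! ### A swirl blob from a non-zero swirl value -/

/-- **A non-zero swirl value yields an off-axis superlevel blob**: if `v` is continuous and `Γ(x₁) = swirl v x₁ ≠ 0`, then `x₁` is off
the axis and there are `0 < δ < r(x₁)`, a level `γ₀ > 0` with `|Γ| ≥ γ₀` on `B(x₁, δ)`, and a volume `0 < V ≤ vol B(x₁,δ)`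
(`Γ = 0` on the axis; continuity of `Γ`). [folklore] -/
theorem exists_swirl_blob {v : EuclideanSpace ℝ (Fin 3) → EuclideanSpace ℝ (Fin 3)} (hv : Continuous v)
    {x₁ : EuclideanSpace ℝ (Fin 3)} (hx₁ : swirl v x₁ ≠ 0) :
    ∃ δ γ₀ V : ℝ, 0 < δ ∧ δ < cylRadius x₁ ∧ 0 < γ₀ ∧ 0 < V ∧
      (∀ x ∈ ball x₁ δ, γ₀ ≤ |swirl v x|) ∧ ENNReal.ofReal V ≤ volume (ball x₁ δ) := by
  have hr : cylRadius x₁ ≠ 0 := fun h => hx₁ (swirl_eq_zero_of_cylRadius_eq_zero v h)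
  have hr0 : 0 < cylRadius x₁ := (cylRadius_nonneg x₁).lt_of_ne' hr
  have hsc : Continuous (swirl v) := (contDiff_swirl (contDiff_zero.2 hv)).continuous
  have hγ : 0 < |swirl v x₁| := abs_pos.2 hx₁
  obtain ⟨ε, hε, hεball⟩ : ∃ ε > 0, ∀ x ∈ ball x₁ ε, |swirl v x₁| / 2 < |swirl v x| := by
    have h := (hsc.abs.continuousAt (x := x₁)).eventually
      (lt_mem_nhds (show |swirl v x₁| / 2 < |swirl v x₁| by linarith))
    obtain ⟨ε, hε, hsub⟩ := Metric.mem_nhds_iff.1 h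
    exact ⟨ε, hε, fun x hx => hsub hx⟩
  set δ : ℝ := min (cylRadius x₁ / 2) ε with hδ
  have hδ0 : 0 < δ := lt_min (by positivity) hε
  have hδr : δ < cylRadius x₁ := lt_of_le_of_lt (min_le_left _ _) (by linarith)
  refine ⟨δ, |swirl v x₁| / 2, (volume (ball x₁ δ)).toReal, hδ0, hδr, by positivity,
    ENNReal.toReal_pos (measure_ball_pos volume x₁ hδ0).ne' measure_ball_lt_top.ne,
    fun x hx => (hεball x (ball_subset_ball (min_le_right _ _) hx)).le, ?_⟩
  rw [ENNReal.ofReal_toReal measure_ball_lt_top.ne]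

/-! ### The exponent race -/

/-- **Powers beat powers times logarithms**: for `e < s` and `c > 0`, `C₁ a^e log a + C₂ a^e + C₃ < c a^s` for all large `a`
(`e ≥ 0`; `log a ≤ a^r/r` with `r = (s−e)/2`). [folklore] -/
theorem eventually_dominates {e s c : ℝ} (he : 0 ≤ e) (hes : e < s) (hc : 0 < c) (C₁ C₂ C₃ : ℝ) :
    ∃ A : ℝ, 1 ≤ A ∧ ∀ a : ℝ, A ≤ a → C₁ * a ^ e * Real.log a + C₂ * a ^ e + C₃ < c * a ^ s := by
  set r : ℝ := (s - e) / 2 with hr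
  have hr0 : 0 < r := by rw [hr]; linarith
  set K : ℝ := |C₁| / r + |C₂| + |C₃| + 1 with hK
  have hK0 : 0 < K := by positivity
  set A : ℝ := max 1 ((K / c) ^ (1 / r) + 1) with hA
  refine ⟨A, le_max_left _ _, fun a ha => ?_⟩
  have ha1 : 1 ≤ a := le_trans (le_max_left _ _) ha
  have ha0 : 0 < a := by linarith
  have hlog0 : 0 ≤ Real.log a := Real.log_nonneg ha1
  have hlog : Real.log a ≤ a ^ r / r := Real.log_le_rpow_div ha0.le hr0
  have hae : 0 < a ^ e := Real.rpow_pos_of_pos ha0 e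
  have haer : a ^ e ≤ a ^ (e + r) := Real.rpow_le_rpow_of_exponent_le ha1 (by linarith)
  have h1er : 1 ≤ a ^ (e + r) := Real.one_le_rpow ha1 (by linarith)
  have hmul : a ^ e * a ^ r = a ^ (e + r) := by rw [← Real.rpow_add ha0]
  -- each term is at most `|C| a^{e+r}`
  have t1 : C₁ * a ^ e * Real.log a ≤ |C₁| / r * a ^ (e + r) := by
    calc C₁ * a ^ e * Real.log a ≤ |C₁| * a ^ e * Real.log a := by
          have := le_abs_self C₁; nlinarith [mul_nonneg hae.le hlog0]
      _ ≤ |C₁| * a ^ e * (a ^ r / r) := by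
          exact mul_le_mul_of_nonneg_left hlog (mul_nonneg (abs_nonneg _) hae.le)
      _ = |C₁| / r * a ^ (e + r) := by rw [← hmul]; field_simp
  have t2 : C₂ * a ^ e ≤ |C₂| * a ^ (e + r) := by
    calc C₂ * a ^ e ≤ |C₂| * a ^ e := mul_le_mul_of_nonneg_right (le_abs_self _) hae.le
      _ ≤ |C₂| * a ^ (e + r) := mul_le_mul_of_nonneg_left haer (abs_nonneg _)
  have t3 : C₃ ≤ |C₃| * a ^ (e + r) := by
    calc C₃ ≤ |C₃| := le_abs_self _
      _ = |C₃| * 1 := (mul_one _).symm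
      _ ≤ |C₃| * a ^ (e + r) := mul_le_mul_of_nonneg_left h1er (abs_nonneg _)
  have hsum : C₁ * a ^ e * Real.log a + C₂ * a ^ e + C₃ < K * a ^ (e + r) := by
    have : (|C₁| / r + |C₂| + |C₃|) * a ^ (e + r) < K * a ^ (e + r) := by
      rw [hK]; nlinarith [h1er]
    nlinarith [t1, t2, t3]
  -- and `K a^{e+r} ≤ c a^s` because `a^r > K/c`
  have har : K / c < a ^ r := by
    have hKc : 0 ≤ K / c := by positivity
    have h1 : (K / c) ^ (1 / r) < a := by linarith [le_max_right 1 ((K / c) ^ (1 / r) + 1)]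
    calc K / c = ((K / c) ^ (1 / r)) ^ r := by rw [← Real.rpow_mul hKc, one_div_mul_cancel hr0.ne', Real.rpow_one]
      _ < a ^ r := Real.rpow_lt_rpow (Real.rpow_nonneg hKc _) h1 hr0
  have hfin : K * a ^ (e + r) ≤ c * a ^ s := by
    have h1 : K ≤ c * a ^ r := by rw [div_lt_iff₀ hc] at har; linarith
    calc K * a ^ (e + r) ≤ c * a ^ r * a ^ (e + r) := mul_le_mul_of_nonneg_right h1 (by linarith)
      _ = c * a ^ s := by rw [mul_assoc, ← Real.rpow_add ha0]; congr 2; rw [hr]; ring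
  exact lt_of_lt_of_le hsum hfin

/-! ### The assembly: the swirl endgame -/

/-- **D3 `stub_swirlEndgame` of the line `swirl-capacity`, signature unfolded**: GIVEN the swirl capacity floor, in the window
`0 < ρ ≤ 1/2` a member of Seregin's power-gauged class which is classical axisymmetric with drift data `(M, κ)`, `(1−ρ)/(2−ρ) < κ < 1`,
carries swirl somewhere in the past and has persistent swirl blobs is trivial — indeed these hypotheses are contradictory (module
docstring). [cite: MajdaBertozziCUP2002, §2.3.3 (2.67); CaffarelliKohnNirenberg1982, §2] -/
theorem vanishesAE_of_swirlCapacityFloor_of_swirlBlobsPersist :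
    (∃ K : ℝ, 0 < K ∧ ∀ (v : EuclideanSpace ℝ (Fin 3) → EuclideanSpace ℝ (Fin 3)) (T : Set (EuclideanSpace ℝ (Fin 3)))
        (A V γ₀ : ℝ), ContDiff ℝ 1 v → IsAxisymmetric v →
        0 < A → 0 < V → 0 < γ₀ → MeasurableSet T → T ⊆ ball (0 : EuclideanSpace ℝ (Fin 3)) A →
        ENNReal.ofReal V ≤ volume T → (∀ x ∈ T, γ₀ ≤ |swirl v x|) →
          ENNReal.ofReal (K * γ₀ ^ 2 / (A * (1 + max 0 (Real.log (A ^ 3 / V))))) ≤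
            ∫⁻ x in ball (0 : EuclideanSpace ℝ (Fin 3)) (3 * A), ENNReal.ofReal (frobeniusNormSq (fderiv ℝ v x))) →
    ∀ ρ : ℝ, 0 < ρ → ρ ≤ 1 / 2 →
      ∀ (u : ℝ → EuclideanSpace ℝ (Fin 3) → EuclideanSpace ℝ (Fin 3)) (p : ℝ → EuclideanSpace ℝ (Fin 3) → ℝ)
        (H : ℝ → EuclideanSpace ℝ (Fin 3) → EuclideanSpace ℝ (Fin 3) →L[ℝ] EuclideanSpace ℝ (Fin 3)) (c : ℝ≥0),
        (IsSuitableWeakSolutionOn (slab (EuclideanSpace ℝ (Fin 3)) (Set.Iio 0) isOpen_Iio) 0 0 u p ∧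
            HasWeakSpatialGradientOn (slab (EuclideanSpace ℝ (Fin 3)) (Set.Iio 0) isOpen_Iio) u H ∧
            (∀ a : ℝ, 0 < a →
              ENNReal.ofReal (a ^ (2 * ρ)) * cknA a (0 : ℝ × EuclideanSpace ℝ (Fin 3)) u +
                    ENNReal.ofReal (a ^ ρ) * cknE a (0 : ℝ × EuclideanSpace ℝ (Fin 3)) H +
                  ENNReal.ofReal (a ^ (2 * ρ)) * cknD a (0 : ℝ × EuclideanSpace ℝ (Fin 3)) p ≤ (c : ℝ≥0∞))) →
          ∀ M κ : ℝ, (1 - ρ) / (2 - ρ) < κ →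
            (IsClassicalEulerSolutionOn (Set.Iio 0) 0 u p ∧
                (∀ τ : ℝ, τ < 0 → IsAxisymmetric (u τ) ∧ IsAxisymmetricScalar (p τ)) ∧
                0 ≤ M ∧ κ < 1 ∧ ∀ τ : ℝ, τ < 0 → ∀ x : EuclideanSpace ℝ (Fin 3), ‖u τ x‖ ≤ M * (-τ) ^ (-κ)) →
            (∃ τ₀ : ℝ, τ₀ < 0 ∧ ∃ x : EuclideanSpace ℝ (Fin 3), swirl (u τ₀) x ≠ 0) →
            (∀ t₀ : ℝ, t₀ < 0 → ∀ (x₀ : EuclideanSpace ℝ (Fin 3)) (δ γ₀ : ℝ), 0 < δ → δ < cylRadius x₀ →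
                (∀ x ∈ ball x₀ δ, γ₀ ≤ |swirl (u t₀) x|) →
                ∀ t₁ : ℝ, t₁ < t₀ →
                  ∃ T : Set (EuclideanSpace ℝ (Fin 3)), MeasurableSet T ∧
                    T ⊆ ball (0 : EuclideanSpace ℝ (Fin 3)) (‖x₀‖ + δ + M / (1 - κ) * ((-t₁) ^ (1 - κ) - (-t₀) ^ (1 - κ))) ∧
                    (∀ x ∈ T, γ₀ ≤ |swirl (u t₁) x|) ∧ volume (ball x₀ δ) ≤ volume T) →
              Function.uncurry u =ᵐ[volume.restrict (Set.Iio (0 : ℝ) ×ˢ (Set.univ : Set (EuclideanSpace ℝ (Fin 3))))] 0 := by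
  intro hfloor ρ hρ hρ2 u p H c hcls M κ hκρ hstr hswirl hpersist
  obtain ⟨K, hK, hfloor⟩ := hfloor
  obtain ⟨_, hH, hgauge⟩ := hcls
  obtain ⟨hcl, hsym, hM0, hκ1, _⟩ := hstr
  obtain ⟨τ₀, hτ₀, x₁, hx₁⟩ := hswirl
  have hE : ∀ a : ℝ, 0 < a →
      ENNReal.ofReal (a ^ ρ) * cknE a (0 : ℝ × EuclideanSpace ℝ (Fin 3)) H ≤ (c : ℝ≥0∞) :=
    fun a ha => (le_add_self.trans le_self_add).trans (hgauge a ha)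
  exfalso
  -- a swirl blob at time `τ₀`
  have hu1 : ∀ t : ℝ, t < 0 → ContDiff ℝ 1 (u t) := fun t ht => (hcl.contDiff_velocity ht).of_le (by exact_mod_cast le_top)
  obtain ⟨δ, γ₀, V, hδ, hδr, hγ₀, hV, hlev, hVball⟩ := exists_swirl_blob (hu1 τ₀ hτ₀).continuous hx₁
  -- the exponents: `e = 2 - ρ < s = min 2 (1/(1-κ))`
  have h1κ : 0 < 1 - κ := by linarith
  set γ : ℝ := 1 / (1 - κ) with hγ
  have hγe : 2 - ρ < γ := by
    rw [hγ, lt_div_iff₀ h1κ]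
    rw [div_lt_iff₀ (by linarith)] at hκρ
    nlinarith
  set s : ℝ := min 2 γ with hs
  have hes : 2 - ρ < s := lt_min (by linarith) hγe
  have hs2 : s ≤ 2 := min_le_left _ _
  have hsγ : s ≤ γ := min_le_right _ _
  -- the constants of the window length `T_a = c₂ a^s`
  set M' : ℝ := max M 1 with hM'
  have hM'0 : 0 < M' := lt_of_lt_of_le one_pos (le_max_right _ _)
  have hMM' : M ≤ M' := le_max_left _ _
  set q : ℝ := (1 - κ) / (6 * M') with hq
  have hq0 : 0 < q := by positivity
  set c₁ : ℝ := q ^ γ with hc₁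
  have hc₁0 : 0 < c₁ := Real.rpow_pos_of_pos hq0 _
  set c₂ : ℝ := min 1 c₁ with hc₂
  have hc₂0 : 0 < c₂ := lt_min one_pos hc₁0
  have hc₂1 : c₂ ≤ 1 := min_le_left _ _
  have hc₂c₁ : c₂ ≤ c₁ := min_le_right _ _
  -- the exponent race
  obtain ⟨A, hA1, hA⟩ := eventually_dominates (e := 2 - ρ) (s := s) (c := c₂ * (K * γ₀ ^ 2)) (by linarith) hes (by positivity)
    (c : ℝ) ((c : ℝ) / 3 * (1 + |Real.log V|)) (-τ₀ * (K * γ₀ ^ 2))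
  -- the radius `a`
  set a : ℝ := max A (6 * (‖x₁‖ + δ)) with ha
  have haA : A ≤ a := le_max_left _ _
  have ha1 : 1 ≤ a := le_trans hA1 haA
  have ha0 : 0 < a := by linarith
  have hax : 6 * (‖x₁‖ + δ) ≤ a := le_max_right _ _
  have hrace := hA a haA
  -- the window length
  set Ta : ℝ := c₂ * a ^ s with hTa
  have hTa0 : 0 < Ta := by positivity
  have has2 : a ^ s ≤ a ^ 2 := by
    rw [show a ^ 2 = a ^ (2 : ℝ) from (Real.rpow_two a).symm]
    exact Real.rpow_le_rpow_of_exponent_le ha1 hs2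
  have hTa2 : Ta ≤ a ^ 2 := by
    calc Ta ≤ 1 * a ^ s := mul_le_mul_of_nonneg_right hc₂1 (Real.rpow_nonneg ha0.le _)
      _ ≤ a ^ 2 := by rw [one_mul]; exact has2
  have hTaγ : Ta ≤ c₁ * a ^ γ :=
    mul_le_mul hc₂c₁ (Real.rpow_le_rpow_of_exponent_le ha1 hsγ) (Real.rpow_nonneg ha0.le _) hc₁0.le
  -- the drift radius on the window `(−T_a, τ₀)` is at most `a/6`
  have hdrift : ∀ t₁ ∈ Ioo (-Ta) τ₀, M / (1 - κ) * ((-t₁) ^ (1 - κ) - (-τ₀) ^ (1 - κ)) ≤ a / 6 := by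
    intro t₁ ht₁
    have hnt₁ : 0 < -t₁ := by linarith [ht₁.2]
    have h0 : 0 ≤ (-τ₀) ^ (1 - κ) := Real.rpow_nonneg (by linarith) _
    have h1 : (-t₁) ^ (1 - κ) ≤ (c₁ * a ^ γ) ^ (1 - κ) :=
      Real.rpow_le_rpow hnt₁.le (by linarith [ht₁.1]) h1κ.le
    have h2 : (c₁ * a ^ γ) ^ (1 - κ) = q * a := by
      rw [Real.mul_rpow hc₁0.le (Real.rpow_nonneg ha0.le _), hc₁, ← Real.rpow_mul hq0.le, ← Real.rpow_mul ha0.le, hγ,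
        one_div_mul_cancel h1κ.ne', Real.rpow_one, Real.rpow_one]
    calc M / (1 - κ) * ((-t₁) ^ (1 - κ) - (-τ₀) ^ (1 - κ)) ≤ M / (1 - κ) * (q * a) := by
          refine mul_le_mul_of_nonneg_left ?_ (div_nonneg hM0 h1κ.le)
          linarith [h1, h2]
      _ ≤ M' / (1 - κ) * (q * a) := by gcongr
      _ = a / 6 := by rw [hq]; field_simp
  -- per-slice floor on the window (capacity floor at `A = a/3`)
  set L : ℝ := 1 + max 0 (Real.log ((a / 3) ^ 3 / V)) with hL
  have hL1 : 1 ≤ L := by rw [hL]; linarith [le_max_left 0 (Real.log ((a / 3) ^ 3 / V))]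
  set F : ℝ := K * γ₀ ^ 2 / (a / 3 * L) with hF
  have hF0 : 0 ≤ F := by positivity
  have hslice : ∀ t₁ ∈ Ioo (-Ta) τ₀, ENNReal.ofReal F ≤
      ∫⁻ x in ball (0 : EuclideanSpace ℝ (Fin 3)) a, ENNReal.ofReal (frobeniusNormSq (fderiv ℝ (u t₁) x)) := by
    intro t₁ ht₁
    have ht₁0 : t₁ < 0 := lt_trans ht₁.2 hτ₀
    obtain ⟨T, hTm, hTsub, hTlev, hTvol⟩ := hpersist τ₀ hτ₀ x₁ δ γ₀ hδ hδr hlev t₁ ht₁.2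
    have hTa3 : T ⊆ ball (0 : EuclideanSpace ℝ (Fin 3)) (a / 3) := by
      refine hTsub.trans (ball_subset_ball ?_)
      linarith [hdrift t₁ ht₁]
    have hfl := hfloor (u t₁) T (a / 3) V γ₀ (hu1 t₁ ht₁0) (hsym t₁ ht₁0).1 (by positivity) hV hγ₀ hTm hTa3
      (hVball.trans hTvol) hTlev
    have h3 : 3 * (a / 3) = a := by ring
    rw [h3] at hfl
    exact hfl
  -- integrate over the window and compare with the budget
  have hlow := frobenius_window_lower_bound hcl (a := a) (α := -Ta) (β := τ₀) (F := F) (by linarith) hτ₀.le hF0 hslice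
  have hbud := setLIntegral_window_frobenius_fderiv_le hH hcl hE ha0 (ρ := ρ)
  have hreal : (τ₀ - -Ta) * F ≤ (c : ℝ) * a ^ (1 - ρ) :=
    (ENNReal.ofReal_le_ofReal_iff (by positivity)).1 (hlow.trans hbud)
  -- unfold `F` and bound the logarithm
  have hlogL : L ≤ 1 + 3 * Real.log a + |Real.log V| := by
    have hlog : Real.log ((a / 3) ^ 3 / V) = 3 * (Real.log a - Real.log 3) - Real.log V := by
      rw [Real.log_div (by positivity) hV.ne', Real.log_pow, Real.log_div ha0.ne' (by norm_num)]
      push_cast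
      ring
    have hlog3 : 0 ≤ Real.log 3 := Real.log_nonneg (by norm_num)
    have hmax : max 0 (Real.log ((a / 3) ^ 3 / V)) ≤ 3 * Real.log a + |Real.log V| := by
      refine max_le (by positivity [Real.log_nonneg ha1]) ?_
      rw [hlog]
      linarith [neg_le_abs (Real.log V)]
    rw [hL]; linarith
  have hkey : (τ₀ + Ta) * (K * γ₀ ^ 2) ≤ (c : ℝ) / 3 * a ^ (2 - ρ) * L := by
    have hpos : 0 < a / 3 * L := by positivity
    have h1 : (τ₀ + Ta) * (K * γ₀ ^ 2) = ((τ₀ - -Ta) * F) * (a / 3 * L) := by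
      rw [hF]; field_simp; ring
    have h2 : (c : ℝ) * a ^ (1 - ρ) * (a / 3 * L) = (c : ℝ) / 3 * a ^ (2 - ρ) * L := by
      have : a ^ (2 - ρ) = a ^ (1 - ρ) * a := by
        rw [show (2 : ℝ) - ρ = (1 - ρ) + 1 by ring, Real.rpow_add ha0, Real.rpow_one]
      rw [this]; ring
    rw [h1, ← h2]
    exact mul_le_mul_of_nonneg_right hreal hpos.le
  have hbig : (τ₀ + Ta) * (K * γ₀ ^ 2) ≤
      (c : ℝ) * a ^ (2 - ρ) * Real.log a + (c : ℝ) / 3 * (1 + |Real.log V|) * a ^ (2 - ρ) := by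
    have hnn : 0 ≤ (c : ℝ) / 3 * a ^ (2 - ρ) := by positivity
    calc (τ₀ + Ta) * (K * γ₀ ^ 2) ≤ (c : ℝ) / 3 * a ^ (2 - ρ) * L := hkey
      _ ≤ (c : ℝ) / 3 * a ^ (2 - ρ) * (1 + 3 * Real.log a + |Real.log V|) := mul_le_mul_of_nonneg_left hlogL hnn
      _ = _ := by ring
  -- the race says the opposite
  have hTam : Ta * (K * γ₀ ^ 2) = c₂ * (K * γ₀ ^ 2) * a ^ s := by rw [hTa]; ring
  nlinarith [hbig, hrace, hTam]

end Summit.NavierStokesRegularity.NavierStokesRegularity.Theorems.PowerGaugeEulerLiouville.SwirlCapacity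

end
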